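import Mathlib
import HarnessLib
import Summits.Ventures.LatticeQCDFlow.Exactness.SUNLeapfrogHMCUniformMinorant
import Summits.Ventures.LatticeQCDFlow.Exactness.UniformDoeblinCertificate
import Summits.Ventures.LatticeQCDFlow.Exactness.SUNJitteredHMCFiguresOfMerit
import Summits.Ventures.LatticeQCDFlow.Exactness.CabibboMarinariORSweep

/-!
# The engine's default fixed-step `SU(N)` HMC: ONE Doeblin certificate — hence ONE `τ_int` constant and ONE burn-in constant — for EVERY trajectory length in a short interval `[τ₁, τ₂]`

HONEST FRAMING: exact (Metropolis-corrected) sampling algorithms for lattice gauge theory;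
figures of merit are autocorrelation/cost numbers at stated couplings and volumes; no
continuum-physics claim.

Venture `LatticeQCDFlow` (cell pub-lqcd), topic `Exactness`, FANOUT row 9 (eng-latcore, GEN-24; the engine's DEFAULT
`hmc.HMC(f, β, 'leapfrog').trajectory(τ, nstep)` — `tau_jitter = 0` — alone, followed by ANY exact step, or inside
`composite_sweep(f, β, 'hmc', n_or)`).  NEW WORK of the cell over GEN-24's `SUNLeapfrogHMCUniformMinorant.lean` (ONE
`(V, κ)` box minorant for every length in `[τ₁, τ₂] ⊂ (0, τ₀]`) and `UniformDoeblinCertificate.lean` (a family sharing a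
box minorant shares ONE certificate), GEN-23's `SUNJitteredHMCFiguresOfMerit.lean` (`doeblinConst_nonneg`), row 13's
`NCMCGeneralSpaceDoeblinPower.lean` (`tauInt_setACF_le_of_nHit`, `chain_timeAverage_bias_le_of_nHit`, `minorised_setwise`),
the tree's `SUNMultiStepLeapfrogHMC.lean` / `SUNWilsonForceLaw.lean` / `CabibboMarinariORSweep.lean`.  Nothing is cited as
a fact; no number is claimed.

WHY.  GEN-23's `SUNLeapfrogHMCORSweepFiguresOfMerit.lean` certifies the fixed-step engine HMC PER step size: the
constants `(m, ε')`, hence `B` in `τ_int(1_A) ≤ 1/2 + B/(1 − π(A))`, are existential for each `τ` separately and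
could a priori blow up as `τ` is tuned.  Here: for every `nstep ≥ 1` and every short interval `[τ₁, τ₂]` ONE pair
`(m, ε')` — hence ONE `B` — serves EVERY trajectory length `τ ∈ [τ₁, τ₂]`.

## Content (`K_τ = wilsonLeapfrogHMC N d L β nstep τ`; `π = wilsonMeasure (β/N)`; `τ₀ > 0` on `N, d, L, β` only)

* §1 **`wilsonLeapfrogHMC N d L β nstep τ`** — the engine's default fixed-step `SU(N)` HMC kernel AS RUN, NAMED
  (`nstep` P-first leapfrog steps of size `τ/nstep`, half kick `−(τ/2nstep)·F`, Wilson force law, Metropolis on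
  `(β/N)·S_W + T`); Markov; `wilsonLeapfrogHMC_invariant`.
* §2 **`wilsonLeapfrogHMC_exactStep_certificate_uniform`** — for every `nstep ≥ 1`, `0 < τ₁ ≤ τ₂ ≤ τ₀` and EVERY
  Wilson-invariant Markov `P`: ONE `(m, ε')` (`m > 0`, `0 < ε' ≤ 1`) with `ε' • π ≤ (P ∘ₖ K_τ)^m(U, ·)` for EVERY
  `τ ∈ [τ₁, τ₂]` and every `U`; **`wilsonLeapfrogHMC_certificate_uniform`** (alone);
  **`wilsonLeapfrogHMC_orSweep_certificate_uniform`** (+ ANY Cabibbo–Marinari OR schedule, `L ≥ 2`).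
* §3 **`wilsonLeapfrogHMC_exactStep_tauInt_setACF_le_uniform`** — ONE `B ≥ 0` with
  `τ_int(1_A) ≤ 1/2 + B/(1 − π(A))` for EVERY `τ ∈ [τ₁, τ₂]` and EVERY event `A` (`0 < π(A) < 1`);
  **`wilsonLeapfrogHMC_exactStep_timeAverage_bias_le_uniform`** — ONE burn-in constant `B` with
  `|E_{μ₀}[(1/n)Σ g(U_t)] − π g| ≤ B/n` for every `τ ∈ [τ₁, τ₂]`, every start, every `[0,1]`-valued `g`, every `n`.

NOT CLAIMED: any value of `τ₀`, `m`, `ε'`, `B`; anything beyond `τ₀`; uniformity in `nstep` or `β`; OMF words; floating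
point.
-/

noncomputable section

namespace Summit.Ventures.LatticeQCDFlow.Exactness

open MeasureTheory ProbabilityTheory ProbabilityTheory.Kernel Set Metric Function Filter Topology
open Literature.MathematicalPhysics.QuantumFieldTheory
open Literature.MathematicalPhysics.QuantumLattice (fundamentalRep continuous_fundamentalRep connectedSpace_specialUnitaryGroup)
open scoped ENNReal Matrix Matrix.Norms.Operator NNReal

set_option backward.isDefEq.respectTransparency false

/-! ## §1 The engine's default fixed-step kernel, named -/

section Kernel

variable (N d L : ℕ) [NeZero L]

/-- **THE ENGINE'S DEFAULT FIXED-STEP `SU(N)` HMC KERNEL AS RUN** (`hmc.HMC(f, β, 'leapfrog').trajectory(τ, nstep)`,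
`tau_jitter = 0`, torus `(ℤ/L)^d`): refresh the momenta (coordinates `sunCoordι N`, Gaussian law of `sunKinetic N`),
`nstep` P-first leapfrog steps of size `τ/nstep` with THE ENGINE'S half kick `−(τ/2nstep)·F(U)`,
`F(U) = sunWilsonForceLaw N β (coeConfig U)`, flip, Metropolis test on `(β/N)·S_W + T`, forget the momenta. -/
def wilsonLeapfrogHMC (β : ℝ) (nstep : ℕ) (τ : ℝ) :
    Kernel (GaugeConfig d L (Matrix.specialUnitaryGroup (Fin N) ℂ)) (GaugeConfig d L (Matrix.specialUnitaryGroup (Fin N) ℂ)) :=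
  sunLeapfrogHMCN (sunCoordι N) (sunCoordι_skew N) (τ / nstep) (Measure.addHaar : Measure (SUNCoords N)) (sunKinetic N)
    (measurable_halfKick_sun N (measurable_sunWilsonForceLaw_coeConfig N (d := d) (L := L) β) (τ / nstep))
    (fun U => β / N * wilsonAction (fundamentalRep (Fin N)) U) nstep

variable {N d L}

/-- The fixed-step kernel is Markov. -/
instance isMarkovKernel_wilsonLeapfrogHMC [NeZero N] (β : ℝ) (nstep : ℕ) (τ : ℝ) :
    IsMarkovKernel (wilsonLeapfrogHMC N d L β nstep τ) := by
  haveI : Fact (Measurable fun z : (GaugeConfig d L (Matrix.specialUnitaryGroup (Fin N) ℂ)) × (Edge d L → SUNCoords N) =>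
      β / N * wilsonAction (fundamentalRep (Fin N)) z.1 + sunKinetic N z.2) :=
    ⟨((measurable_engineWilsonAction N β).comp measurable_fst).add ((measurable_sunKinetic N).comp measurable_snd)⟩
  haveI := isProbabilityMeasure_sunMomentumLaw (L := Edge d L) (Measure.addHaar : Measure (SUNCoords N)) (sunKinetic N)
    (measurable_sunKinetic N) (sunMomentumWeight_sunKinetic_ne_top N Measure.addHaar)
  unfold wilsonLeapfrogHMC sunLeapfrogHMCN; infer_instance

/-- **EXACT** (every `nstep`, every `τ`): `wilsonMeasure (β/N)` is invariant. -/
theorem wilsonLeapfrogHMC_invariant [NeZero N] (β : ℝ) (nstep : ℕ) (τ : ℝ) :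
    Invariant (wilsonLeapfrogHMC N d L β nstep τ) (wilsonMeasure (d := d) (L := L) (fundamentalRep (Fin N)) (β / N)) := by
  rw [← gibbsProbability_smul_wilsonAction_eq N (d := d) (L := L) (fundamentalRep (Fin N)) (β / N)]
  exact sunLeapfrogHMCN_invariant_gibbs (sunCoordι N) (sunCoordι_skew N) _ (measurable_sunKinetic N)
    (sunMomentumWeight_sunKinetic_ne_top N Measure.addHaar) (measurable_engineWilsonAction N β) nstep

end Kernel

/-! ## §2 ONE certificate for every trajectory length in `[τ₁, τ₂]` -/

section Certificates

variable {N d L : ℕ} [NeZero N] [NeZero L] (β : ℝ)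

/-- **ONE DOEBLIN CERTIFICATE FOR EVERY TRAJECTORY LENGTH IN A SHORT INTERVAL, FOLLOWED BY ANY EXACT STEP.**  There is
`τ₀ > 0` (on `N, d, L, β` only) such that for every `nstep ≥ 1`, every `0 < τ₁ ≤ τ₂ ≤ τ₀` and EVERY Markov kernel `P`
leaving `wilsonMeasure (β/N)` invariant there are ONE `m > 0` and ONE `0 < ε' ≤ 1` with
`ε' • wilsonMeasure (β/N) ≤ (P ∘ₖ K_τ)^m(U, ·)` for EVERY `τ ∈ [τ₁, τ₂]` and EVERY `U`. -/
theorem wilsonLeapfrogHMC_exactStep_certificate_uniform :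
    ∃ τ₀ : ℝ, 0 < τ₀ ∧ ∀ (nstep : ℕ) (τ₁ τ₂ : ℝ), 1 ≤ nstep → 0 < τ₁ → τ₁ ≤ τ₂ → τ₂ ≤ τ₀ →
      ∀ (P : Kernel (GaugeConfig d L (Matrix.specialUnitaryGroup (Fin N) ℂ))
          (GaugeConfig d L (Matrix.specialUnitaryGroup (Fin N) ℂ))) [IsMarkovKernel P],
        Invariant P (wilsonMeasure (d := d) (L := L) (fundamentalRep (Fin N)) (β / N)) →
      ∃ m : ℕ, ∃ ε' : ℝ≥0∞, 0 < m ∧ 0 < ε' ∧ ε' ≤ 1 ∧ ∀ τ ∈ Icc τ₁ τ₂,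
        ∀ U : GaugeConfig d L (Matrix.specialUnitaryGroup (Fin N) ℂ),
          ε' • wilsonMeasure (d := d) (L := L) (fundamentalRep (Fin N)) (β / N) ≤
            nHit (P ∘ₖ wilsonLeapfrogHMC N d L β nstep τ) m U := by
  haveI : ConnectedSpace (Matrix.specialUnitaryGroup (Fin N) ℂ) := connectedSpace_specialUnitaryGroup
  obtain ⟨s, hs⟩ := exists_bound_smul_wilsonAction_sun N (d := d) (L := L) _ (continuous_fundamentalRep (Fin N)) (β / N)
  obtain ⟨Fmax, KF, hF0, hKF0, hFb, hFK⟩ := sunWilsonForceLaw_bounds N (d := d) (L := L) β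
  obtain ⟨τ₀, hτ₀, hbox⟩ := engine_sunLeapfrogHMCN_box_minorised_uniform_of_trajLength N
    (measurable_sunWilsonForceLaw_coeConfig N (d := d) (L := L) β) hF0 hFb hKF0 hFK (measurable_engineWilsonAction N β) hs
  refine ⟨τ₀, hτ₀, fun nstep τ₁ τ₂ hn hτ₁ h12 hτ₂ P _ hP => ?_⟩
  obtain ⟨V, hVo, hV1, κ, hκ, hK⟩ := hbox nstep τ₁ τ₂ hn hτ₁ h12 hτ₂
  obtain ⟨hlo, hhi⟩ := gibbsWeight_pinched (L := Edge d L) (n := Fin N) hs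
  have heq := gibbsProbability_smul_wilsonAction_eq N (d := d) (L := L) (fundamentalRep (Fin N)) (β / N)
  rw [← heq] at hP
  obtain ⟨mm, a, ha, hmin⟩ := exactStep_nHit_minorised_uniform_of_box_minorised (ι := Edge d L) (Real.exp_pos (-s)) hlo hhi
    (T := Icc τ₁ τ₂) (K := fun τ => wilsonLeapfrogHMC N d L β nstep τ) hVo hV1 hκ (fun τ hτ U => hK τ hτ U) P hP
  rw [heq] at hmin
  haveI : IsMarkovKernel (nHit (P ∘ₖ wilsonLeapfrogHMC N d L β nstep τ₁) (mm + 1)) := isMarkovKernel_nHit _ _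
  have ha1 : a ≤ 1 := by
    have h1 := Measure.le_iff'.1 (hmin τ₁ ⟨le_rfl, h12⟩ fun _ => 1) univ
    rwa [Measure.smul_apply, smul_eq_mul, measure_univ, measure_univ, mul_one] at h1
  exact ⟨mm + 1, a, Nat.succ_pos mm, pos_iff_ne_zero.2 ha, ha1, hmin⟩

/-- **ONE CERTIFICATE FOR EVERY LENGTH IN `[τ₁, τ₂]`, THE UPDATE ALONE** (`P = id`). -/
theorem wilsonLeapfrogHMC_certificate_uniform :
    ∃ τ₀ : ℝ, 0 < τ₀ ∧ ∀ (nstep : ℕ) (τ₁ τ₂ : ℝ), 1 ≤ nstep → 0 < τ₁ → τ₁ ≤ τ₂ → τ₂ ≤ τ₀ →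
      ∃ m : ℕ, ∃ ε' : ℝ≥0∞, 0 < m ∧ 0 < ε' ∧ ε' ≤ 1 ∧ ∀ τ ∈ Icc τ₁ τ₂,
        ∀ U : GaugeConfig d L (Matrix.specialUnitaryGroup (Fin N) ℂ),
          ε' • wilsonMeasure (d := d) (L := L) (fundamentalRep (Fin N)) (β / N) ≤ nHit (wilsonLeapfrogHMC N d L β nstep τ) m U := by
  obtain ⟨τ₀, hτ₀, h⟩ := wilsonLeapfrogHMC_exactStep_certificate_uniform (N := N) (d := d) (L := L) β
  refine ⟨τ₀, hτ₀, fun nstep τ₁ τ₂ hn hτ₁ h12 hτ₂ => ?_⟩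
  obtain ⟨m, ε', hm, hε', hε'1, hmin⟩ := h nstep τ₁ τ₂ hn hτ₁ h12 hτ₂ Kernel.id invariant_id
  exact ⟨m, ε', hm, hε', hε'1, fun τ hτ U => by simpa only [Kernel.id_comp] using hmin τ hτ U⟩

variable {mC : Type*} [Fintype mC] [DecidableEq mC]

/-- **ONE CERTIFICATE FOR EVERY LENGTH IN `[τ₁, τ₂]`, THE ENGINE'S DEFAULT `'hmc' + n_or × 'or'` COMPOSITE AS RUN**
(`L ≥ 2`, `P` = ANY schedule `sched` of Cabibbo–Marinari over-relaxation hits; the pair `(m, ε')` serves every `τ` in the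
interval for that schedule). -/
theorem wilsonLeapfrogHMC_orSweep_certificate_uniform (hL : 2 ≤ L) :
    ∃ τ₀ : ℝ, 0 < τ₀ ∧ ∀ (nstep : ℕ) (τ₁ τ₂ : ℝ) (sched : List (Edge d L × (Fin N ≃ Fin 2 ⊕ mC))),
      1 ≤ nstep → 0 < τ₁ → τ₁ ≤ τ₂ → τ₂ ≤ τ₀ →
      ∃ m : ℕ, ∃ ε' : ℝ≥0∞, 0 < m ∧ 0 < ε' ∧ ε' ≤ 1 ∧ ∀ τ ∈ Icc τ₁ τ₂,
        ∀ U : GaugeConfig d L (Matrix.specialUnitaryGroup (Fin N) ℂ),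
          ε' • wilsonMeasure (d := d) (L := L) (fundamentalRep (Fin N)) (β / N) ≤
            nHit (cmORSweep sched ∘ₖ wilsonLeapfrogHMC N d L β nstep τ) m U := by
  obtain ⟨τ₀, hτ₀, h⟩ := wilsonLeapfrogHMC_exactStep_certificate_uniform (N := N) (d := d) (L := L) β
  refine ⟨τ₀, hτ₀, fun nstep τ₁ τ₂ sched hn hτ₁ h12 hτ₂ => h nstep τ₁ τ₂ hn hτ₁ h12 hτ₂ (cmORSweep sched) ?_⟩
  rw [← gibbsProbability_smul_wilsonAction_eq N (d := d) (L := L) (fundamentalRep (Fin N)) (β / N)]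
  refine invariant_gibbsProbability ?_
  have hdens : (fun U : GaugeConfig d L (Matrix.specialUnitaryGroup (Fin N) ℂ) =>
      ENNReal.ofReal (Real.exp (-(β / N * wilsonAction (fundamentalRep (Fin N)) U)))) =
      gibbsDensity fun U : GaugeConfig d L (Matrix.specialUnitaryGroup (Fin N) ℂ) => β / N * wilsonAction (suRep N) U := by
    funext U; rfl
  rw [hdens]
  exact cmORSweep_invariant (β / N) hL sched

/-! ## §3 ONE `τ_int` constant and ONE burn-in constant for every length in `[τ₁, τ₂]` -/

/-- **ONE `τ_int` CONSTANT FOR EVERY TRAJECTORY LENGTH IN `[τ₁, τ₂]` AND EVERY EVENT** (the update followed by ANY exact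
step): there is `B ≥ 0` — the same for all `τ ∈ [τ₁, τ₂]` — with `τ_int(1_A) ≤ 1/2 + B/(1 − π(A))` for EVERY measurable `A`
with `0 < π(A) < 1`, `π = wilsonMeasure (β/N)`. -/
theorem wilsonLeapfrogHMC_exactStep_tauInt_setACF_le_uniform :
    ∃ τ₀ : ℝ, 0 < τ₀ ∧ ∀ (nstep : ℕ) (τ₁ τ₂ : ℝ), 1 ≤ nstep → 0 < τ₁ → τ₁ ≤ τ₂ → τ₂ ≤ τ₀ →
      ∀ (P : Kernel (GaugeConfig d L (Matrix.specialUnitaryGroup (Fin N) ℂ))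
          (GaugeConfig d L (Matrix.specialUnitaryGroup (Fin N) ℂ))) [IsMarkovKernel P],
        Invariant P (wilsonMeasure (d := d) (L := L) (fundamentalRep (Fin N)) (β / N)) →
      ∃ B : ℝ, 0 ≤ B ∧ ∀ τ ∈ Icc τ₁ τ₂, ∀ A : Set (GaugeConfig d L (Matrix.specialUnitaryGroup (Fin N) ℂ)), MeasurableSet A →
        0 < (wilsonMeasure (d := d) (L := L) (fundamentalRep (Fin N)) (β / N)).real A →
        (wilsonMeasure (d := d) (L := L) (fundamentalRep (Fin N)) (β / N)).real A < 1 →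
        Scoring.tauInt (setACF (P ∘ₖ wilsonLeapfrogHMC N d L β nstep τ)
            (wilsonMeasure (d := d) (L := L) (fundamentalRep (Fin N)) (β / N)) A) ≤
          1 / 2 + B / (1 - (wilsonMeasure (d := d) (L := L) (fundamentalRep (Fin N)) (β / N)).real A) := by
  obtain ⟨τ₀, hτ₀, h⟩ := wilsonLeapfrogHMC_exactStep_certificate_uniform (N := N) (d := d) (L := L) β
  refine ⟨τ₀, hτ₀, fun nstep τ₁ τ₂ hn hτ₁ h12 hτ₂ P _ hP => ?_⟩
  obtain ⟨m, ε', hm, hε0, hε1, hmin⟩ := h nstep τ₁ τ₂ hn hτ₁ h12 hτ₂ P hP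
  refine ⟨(m : ℝ) / ε'.toReal - 1, doeblinConst_nonneg hm hε0 hε1, fun τ hτ A hA h0 h1 => ?_⟩
  exact GeneralNCMC.tauInt_setACF_le_of_nHit (GeneralNCMC.minorised_setwise (hmin τ hτ)) hε0 hε1 hm
    (hP.comp (wilsonLeapfrogHMC_invariant (N := N) (d := d) (L := L) β nstep τ)) hA h0 h1

/-- **ONE BURN-IN CONSTANT FOR EVERY TRAJECTORY LENGTH IN `[τ₁, τ₂]`** (the update followed by ANY exact step): there
is `B ≥ 0` with `|E_{μ₀}[(1/n) Σ_{t<n} g(U_t)] − ∫ g dπ| ≤ B/n` for EVERY `τ ∈ [τ₁, τ₂]`, EVERY initial law `μ₀`, every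
`[0,1]`-valued measurable `g`, every `n ≥ 1`. -/
theorem wilsonLeapfrogHMC_exactStep_timeAverage_bias_le_uniform :
    ∃ τ₀ : ℝ, 0 < τ₀ ∧ ∀ (nstep : ℕ) (τ₁ τ₂ : ℝ), 1 ≤ nstep → 0 < τ₁ → τ₁ ≤ τ₂ → τ₂ ≤ τ₀ →
      ∀ (P : Kernel (GaugeConfig d L (Matrix.specialUnitaryGroup (Fin N) ℂ))
          (GaugeConfig d L (Matrix.specialUnitaryGroup (Fin N) ℂ))) [IsMarkovKernel P],
        Invariant P (wilsonMeasure (d := d) (L := L) (fundamentalRep (Fin N)) (β / N)) →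
      ∃ B : ℝ, 0 ≤ B ∧ ∀ τ ∈ Icc τ₁ τ₂,
        ∀ (μ₀ : Measure (GaugeConfig d L (Matrix.specialUnitaryGroup (Fin N) ℂ))) [IsProbabilityMeasure μ₀]
          (g : GaugeConfig d L (Matrix.specialUnitaryGroup (Fin N) ℂ) → ℝ), Measurable g → (∀ U, 0 ≤ g U) → (∀ U, g U ≤ 1) →
        ∀ n : ℕ, n ≠ 0 →
        |∫ x, (∑ t ∈ Finset.range n, g (x t)) / n
            ∂(Kernel.trajMeasure (X := fun _ : ℕ => GaugeConfig d L (Matrix.specialUnitaryGroup (Fin N) ℂ)) μ₀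
              (fun t : ℕ => (P ∘ₖ wilsonLeapfrogHMC N d L β nstep τ).comap
                (fun h : (i : ↥(Finset.Iic t)) → GaugeConfig d L (Matrix.specialUnitaryGroup (Fin N) ℂ) =>
                  h ⟨t, Finset.mem_Iic.2 le_rfl⟩) (measurable_pi_apply _)))
          - ∫ U, g U ∂(wilsonMeasure (d := d) (L := L) (fundamentalRep (Fin N)) (β / N))| ≤ B / n := by
  obtain ⟨τ₀, hτ₀, h⟩ := wilsonLeapfrogHMC_exactStep_certificate_uniform (N := N) (d := d) (L := L) β
  refine ⟨τ₀, hτ₀, fun nstep τ₁ τ₂ hn hτ₁ h12 hτ₂ P _ hP => ?_⟩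
  obtain ⟨m, ε', hm, hε0, hε1, hmin⟩ := h nstep τ₁ τ₂ hn hτ₁ h12 hτ₂ P hP
  have he0 : 0 < ε'.toReal := ENNReal.toReal_pos hε0.ne' (ne_top_of_le_ne_top ENNReal.one_ne_top hε1)
  refine ⟨(m : ℝ) / ε'.toReal, by positivity, fun τ hτ μ₀ _ g hg h0 h1 n hn' => ?_⟩
  calc _ ≤ (m : ℝ) / (ε'.toReal * n) :=
        GeneralNCMC.chain_timeAverage_bias_le_of_nHit (GeneralNCMC.minorised_setwise (hmin τ hτ)) hε0 hε1 hm
          (hP.comp (wilsonLeapfrogHMC_invariant (N := N) (d := d) (L := L) β nstep τ)) μ₀ hg h0 h1 hn'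
    _ = (m : ℝ) / ε'.toReal / n := by rw [div_div]

end Certificates

end Summit.Ventures.LatticeQCDFlow.Exactness
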